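import Literature.Computability.Cryptography.InaccessibleEntropyUOWHFBridge
import Literature.Computability.Cryptography.InaccessibleEntropyUOWHFBound
import HarnessLib

/-!
# One-way functions ⇒ UOWHF, XI: the asymptotic assembly (Rompel's theorem, HHRVW's proof)

Topic `Literature/Computability/Cryptography`; nineteenth and last file of the core of the "one-way
functions ⇒ universal one-way hash functions" line (Haitner–Holenstein–Reingold–Vadhan–Wee 2020, Thm. 5.1
with Thm. 4.5; Rompel 1990; Goldreich 2004, Thm. 6.4.29 whose proof the book omits). From a length-preserving
one-way function `f` we obtain the explicit string family `HHRVW.family p f` (file VII) and prove that it is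
a *leveled* collection of `(d, d−1)`-restricted UOWHFs: efficient, length-regular, with indices of length
`n + 1 + p(n)` at parameter `n`, and such that every PPT designated-collision adversary `(A₀, A)` succeeds
inside the domain only with negligible probability (`superpolynomialDecay_rtcrProb`). The normalisation of
the index length to exactly `n` (Goldreich's Def. 6.4.19 (1)) and Steps II–IV of §6.4.3 are separate files.

The proof: for each `n` with the collision-pair condition `8·CP(f)·M ≤ 2^{2n}` (which holds for all large
`n` by one-wayness, via the coin-echo inverter `echo`), Theorem 4.5 gives the entropy gap
`accH + a/(12M) ≤ realH` for the base function on triples; the window lemma picks the grid index `j` whose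
thresholds `k_j = j·a/(64M)` separate accessible from real entropy; the UOWHF bridge bounds the collision
probability by the single-candidate counts at `(j, r)`, `CandData.tcr_prob_le` bounds each by
`T·invSum/… + ε` with `ε ≤ 3e^{−2n} + 25·2^{−u(n)}`, and the inverter bridge turns `Σ_r invSum` into
`2^{aJ+aR}·M·t · Pr[inverter inverts f]`; negligibility survives the polynomial factors.

All statements proved; no named facts.

## References

* I. Haitner, T. Holenstein, O. Reingold, S. Vadhan, H. Wee, *Inaccessible Entropy II: IE Functions and
  Universal One-Way Hashing*, Theory of Computing 16(8) (2020), Thm. 4.5, Thm. 5.1 (proof, Steps 1–5).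
* J. Rompel, *One-way functions are necessary and sufficient for secure signatures*, STOC 1990.
* O. Goldreich, *Foundations of Cryptography II*, CUP 2004, §6.4.3, Def. 6.4.19, Thm. 6.4.29.
-/

namespace Literature.Computability.Cryptography

namespace HHRVW

open _root_.Computability Complexity Complexity.BitCodec Complexity.Brick AffineStr Sz Finset Polynomial Filter Asymptotics LeftoverHash

/-! ### Generic facts -/

section Generic

variable {α β : Type*} [Fintype α] [DecidableEq β]

/-- The real entropy of `F⁻¹` is at most `log₂ |α|`. [cite: HaitnerEtAl2020, Def. 3.1] -/
theorem realEntropy_le_logb_card [Nonempty α] (F : α → β) : realEntropy F ≤ Real.logb 2 (Fintype.card α) := by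
  unfold realEntropy
  rw [div_le_iff₀ (by exact_mod_cast Fintype.card_pos)]
  calc ∑ a, Real.logb 2 ((fiber univ F (F a)).card : ℝ) ≤ ∑ _a : α, Real.logb 2 (Fintype.card α : ℝ) :=
        Finset.sum_le_sum fun a _ => Real.logb_le_logb_of_le (by norm_num)
          (by have : 0 < (fiber univ F (F a)).card := Finset.card_pos.2 ⟨a, by simp⟩
              exact_mod_cast this)
          (by exact_mod_cast Finset.card_le_univ _)
    _ = Real.logb 2 (Fintype.card α) * Fintype.card α := by rw [Finset.sum_const, Finset.card_univ, nsmul_eq_mul, mul_comm]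

omit [DecidableEq β] in
/-- The accessible average max-entropy of a family of nonempty sets is nonnegative. [cite: HaitnerEtAl2020, Def. 3.9] -/
theorem accEntropy_nonneg_of_pos (L : α → Finset α) (hL : ∀ a, 0 < (L a).card) : 0 ≤ accEntropy L :=
  div_nonneg (Finset.sum_nonneg fun a _ => Real.logb_nonneg (by norm_num) (by exact_mod_cast hL a)) (Nat.cast_nonneg _)

/-- `p(n)/2ⁿ` is negligible for every polynomial `p`. [folklore] -/
theorem superpolynomialDecay_natPoly_div_two_pow (P : Polynomial ℕ) :
    SuperpolynomialDecay atTop (fun n : ℕ => (n : ℝ)) (fun n => ((P.eval n : ℕ) : ℝ) / 2 ^ n) := by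
  have h0 : SuperpolynomialDecay atTop (fun n : ℕ => (n : ℝ)) (fun n => ((1 : ℝ) / 2) ^ n) := by
    intro m
    exact tendsto_pow_const_mul_const_pow_of_abs_lt_one m (r := (1 : ℝ) / 2) (by rw [abs_of_pos (by norm_num)]; norm_num)
  refine (h0.polynomial_mul (P.map (Nat.castRingHom ℝ))).congr fun n => ?_
  rw [Polynomial.eval_map, Polynomial.eval₂_at_natCast, one_div_pow]
  simp only [eq_natCast, Nat.cast_id]
  ring

/-- The window lemma: with the gap `Ea + a/(12M) ≤ Er`, the grid index `j := ⌊Er/c⌋`, `c := a/(64M)`, has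
`j ≥ 5`, `c(j−1) ≤ Er` and `Ea + c ≤ c(j−3)` (the thresholds of HHRVW's Step 1 with `Δ/4 := c`).
[cite: HaitnerEtAl2020, proof of Thm. 5.1, Step 1 (choice of `k ∈ [realH, realH + Δ/4]`)] -/
theorem window {Ea Er a M : ℝ} (ha : 1 ≤ a) (hM : 0 < M) (hEa : 0 ≤ Ea) (hgap : Ea + a / (12 * M) ≤ Er) :
    4 < ⌊Er / (a / (64 * M))⌋₊ ∧ a / (64 * M) * ((⌊Er / (a / (64 * M))⌋₊ : ℝ) - 1) ≤ Er ∧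
      Ea + a / (64 * M) ≤ a / (64 * M) * ((⌊Er / (a / (64 * M))⌋₊ : ℝ) - 3) := by
  set c := a / (64 * M) with hc
  have hc0 : 0 < c := by positivity
  have hEr : 0 ≤ Er := le_trans (by positivity) hgap
  have h1 : (⌊Er / c⌋₊ : ℝ) ≤ Er / c := Nat.floor_le (by positivity)
  have h2 : Er / c < ⌊Er / c⌋₊ + 1 := Nat.lt_floor_add_one _
  have h1' : c * (⌊Er / c⌋₊ : ℝ) ≤ Er := by rwa [← le_div_iff₀' hc0]
  have h2' : Er < c * ((⌊Er / c⌋₊ : ℝ) + 1) := by rwa [← div_lt_iff₀' hc0]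
  have hgap' : Ea + 16 / 3 * c ≤ Er := by
    have : a / (12 * M) = 16 / 3 * c := by rw [hc]; field_simp; ring
    linarith
  refine ⟨?_, by nlinarith, by nlinarith⟩
  have h5 : (4 : ℝ) < ⌊Er / c⌋₊ := by nlinarith
  exact_mod_cast h5

end Generic

/-! ### The coin-echo inverter and the collision-pair condition -/

section Echo

/-- **The coin-echo inverter**: on `(1ⁿ, y)` output `n` fresh coins. Its inversion probability is the
collision probability `CP(f)/2^{2n}`, so one-wayness makes `CP(f)·poly(n) ≤ 2^{2n}` hold for all large `n`.
[cite: HaitnerEtAl2020, Thm. 4.5 (hypothesis on `f`); Goldreich 2001, Def. 2.2.1] -/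
def echo : RandAlg (List Bool) (List Bool) where
  run inp c := sndF (boolPair inp c)
  coinLen Lin := nOfLen Lin

/-- The echo outputs its coins. [folklore] -/
@[simp] theorem echo_run (inp c : List Bool) : echo.run inp c = c := by simp [echo, sndF]

/-- The echo is PPT. [folklore] -/
theorem isPPT_echo : IsPPT echo id := by
  refine ⟨?_, ⟨Polynomial.X, fun L => ?_⟩⟩
  · obtain ⟨pc, Mc, hM⟩ := sndF_mem_FP
    exact ⟨pc, Mc, fun z => hM (boolPair z.1 z.2)⟩
  · show nOfLen L ≤ _
    rw [Polynomial.eval_X, nOfLen]; omega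

/-- **`CP(f) = 2^{2n} · Pr[echo inverts f]`** on `{0,1}ⁿ` for length-preserving `f`. [cite: HaitnerEtAl2020, §2.3 with Thm. 4.5] -/
theorem collPairs_eq_invertProb_echo {f : List Bool → List Bool} (hf : IsLengthPreserving f) (n : ℕ) :
    (collPairs (fun x : Xv n => f x.toList) : ℝ) = 2 ^ n * 2 ^ n * invertProb f echo n := by
  classical
  have hpr : ∀ x : Xv n, echo.pr id (boolPair (unaryEncodeNat n) (f x.toList)) {z | f z = f x.toList} =
      (∑ c : Xv n, if f c.toList = f x.toList then (1 : ℝ) else 0) / 2 ^ n := fun x => by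
    rw [LenPres.pr_eq_uniformAvg_ite _ _ _ _ (k := n) (nOfLen_eq n (by rw [hf, List.Vector.toList_length])), uniformAvg]
    simp only [echo_run, Set.mem_setOf_eq]
  rw [invertProb, uniformAvg, Finset.sum_congr rfl fun x _ => hpr x, ← Finset.sum_div, collPairs]
  push_cast
  rw [Finset.sum_congr rfl fun (x : Xv n) _ => show (imgCard (fun x : Xv n => f x.toList) (f x.toList) : ℝ) =
      ∑ c : Xv n, if f c.toList = f x.toList then (1 : ℝ) else 0 by rw [imgCard, fiber, Finset.natCast_card_filter]]
  field_simp

/-- The collision-pair condition of Theorem 4.5 holds as soon as the echo inverts with probability `≤ 1/(8M)`.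
[cite: HaitnerEtAl2020, Thm. 4.5] -/
theorem collPairs_cond_of_invertProb_le {f : List Bool → List Bool} (hf : IsLengthPreserving f) {n : ℕ}
    (h : invertProb f echo n ≤ 1 / (8 * M n)) :
    8 * collPairs (fun x : Xv n => f x.toList) * M n ≤ Fintype.card (Xv n) ^ 2 := by
  have hM : (0 : ℝ) < M n := by exact_mod_cast M_pos n
  have hR : (8 * collPairs (fun x : Xv n => f x.toList) * M n : ℝ) ≤ (Fintype.card (Xv n) : ℝ) ^ 2 := by
    rw [collPairs_eq_invertProb_echo hf, card_vector, Fintype.card_bool]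
    push_cast
    have := mul_le_mul_of_nonneg_left h (show (0 : ℝ) ≤ 8 * (2 ^ n * 2 ^ n) * M n by positivity)
    calc (8 : ℝ) * (2 ^ n * 2 ^ n * invertProb f echo n) * M n = 8 * (2 ^ n * 2 ^ n) * M n * invertProb f echo n := by ring
      _ ≤ 8 * (2 ^ n * 2 ^ n) * M n * (1 / (8 * M n)) := this
      _ = (2 ^ n) ^ 2 := by field_simp
  exact_mod_cast hR

/-- **One-wayness gives the collision-pair condition for all large `n`.** [cite: HaitnerEtAl2020, Thm. 4.5 with §2.3] -/
theorem eventually_collPairs_cond {f : List Bool → List Bool} (hf : IsOneWay f) (hlp : IsLengthPreserving f) :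
    ∀ᶠ n in atTop, 8 * collPairs (fun x : Xv n => f x.toList) * M n ≤ Fintype.card (Xv n) ^ 2 := by
  have hneg := hf.2 echo isPPT_echo
  -- `n² · Pr[echo inverts] → 0`, so eventually `Pr ≤ 1/n² ≤ 1/(8M)` (`M ≤ 2n + 1`, `n ≥ 24`)
  have h2 : Tendsto (fun n : ℕ => (n : ℝ) ^ 2 * invertProb f echo n) atTop (nhds 0) := hneg 2
  have hev : ∀ᶠ n : ℕ in atTop, (n : ℝ) ^ 2 * invertProb f echo n ≤ 1 := by
    have := h2.eventually (Iic_mem_nhds (show (0 : ℝ) < 1 by norm_num))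
    filter_upwards [this] with n hn using hn
  filter_upwards [hev, eventually_ge_atTop 24] with n hn hn24
  refine collPairs_cond_of_invertProb_le hlp ?_
  have hn0 : (0 : ℝ) < n := by exact_mod_cast (show 0 < n by omega)
  have hMle : (M n : ℝ) ≤ 2 * n + 1 := by exact_mod_cast M_le n
  have hM0 : (0 : ℝ) < M n := by exact_mod_cast M_pos n
  have hIP : invertProb f echo n ≤ 1 / (n : ℝ) ^ 2 := by
    rw [le_div_iff₀ (by positivity)]; linarith [mul_comm ((n : ℝ) ^ 2) (invertProb f echo n)]
  refine hIP.trans ?_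
  rw [div_le_div_iff₀ (by positivity) (by positivity), one_mul, one_mul]
  have h24 : (24 : ℝ) ≤ n := by exact_mod_cast hn24
  nlinarith

end Echo

/-! ### Sizes -/

section Sizes

variable (n : ℕ)

/-- `a(n) ≥ 1` for `n ≥ 1`. [folklore] -/
theorem one_le_a {n : ℕ} (hn : 1 ≤ n) : 1 ≤ a n := by
  rw [a]; by_contra h; push Not at h
  have h0 : encodeNat n = [] := List.eq_nil_of_length_eq_zero (by omega)
  have := congrArg bitsToNat h0
  simp at this; omega

/-- `1 ≤ u(n)` for `n ≥ 1`. [folklore] -/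
theorem one_le_u {n : ℕ} (hn : 1 ≤ n) : 1 ≤ u n := le_trans hn (le_u hn)

/-- `|{0,1}ⁿ| = 2ⁿ`. [folklore] -/
theorem card_Xv : Fintype.card (Xv n) = 2 ^ n := by rw [card_vector, Fintype.card_bool]

/-- `|𝒦| = 2^{ℓ_K}`. [folklore] -/
theorem card_Kv : Fintype.card (Kv n) = 2 ^ lK n := by rw [card_vector, Fintype.card_bool]

/-- `|G₂| = 2^{|g₂|}`. [folklore] -/
theorem card_G2v : Fintype.card (G2v n) = 2 ^ G2 n := by rw [card_vector, Fintype.card_bool]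

/-- `|G₃| = 2^{|g₃|}`. [folklore] -/
theorem card_G3v : Fintype.card (G3v n) = 2 ^ G3 n := by rw [card_vector, Fintype.card_bool]

/-- The size of the coin type of the `(j, r)`-adversary. [folklore] -/
theorem card_CoinsJR (qn lo : ℕ) : Fintype.card (CoinsJR n qn lo) =
    (2 ^ N n) ^ (R n + 1) * (((2 ^ N n) ^ (R n + 1)) ^ Jp1 n * (2 ^ qn * 2 ^ lo)) := by
  simp only [Fintype.card_prod, Fintype.card_fun, Fintype.card_fin, ZMod.card, card_vector, Fintype.card_bool]

/-- `log₂ |Dom| = d₀`. [folklore] -/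
theorem logb_card_Dom : Real.logb 2 (Fintype.card (Dom n) : ℝ) = d0 n := by
  rw [card_Dom]; push_cast
  rw [Real.logb_pow, Real.logb_self_eq_one (by norm_num), mul_one]

/-- `(cand n j f).f = f` on `{0,1}ⁿ`, independently of `j`. [folklore] -/
theorem cand_f (j : ℕ) (f : List Bool → List Bool) : (cand n j f).f = fun x => f x.toList := rfl

/-- `(cand n j f).hp` is the affine hashed prefix, independently of `j`. [folklore] -/
theorem cand_hp (j : ℕ) (f : List Bool → List Bool) : (cand n j f).hp = affinePrefix n (M n) (lK n) (padV n) := rfl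

/-- `t · a/(64M) = 2u`. [folklore] -/
theorem t_mul_c : (t n : ℝ) * ((a n : ℝ) / (64 * M n)) = 2 * u n := by
  have hM : (0 : ℝ) < M n := by exact_mod_cast M_pos n
  rw [t, u]; push_cast; field_simp; ring

/-- `t · (a/(64M))² ≥ n · d₀²` (so `t η² ≥ n` for `η = a/(64 M d₀)`), for `n ≥ 1`. [cite: HaitnerEtAl2020, proof of Thm. 5.1, Step 1 (choice of `t`)] -/
theorem n_mul_d0_sq_le {n : ℕ} (hn : 1 ≤ n) : (n : ℝ) * (d0 n : ℝ) ^ 2 ≤ (t n : ℝ) * ((a n : ℝ) / (64 * M n)) ^ 2 := by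
  have hM : (0 : ℝ) < M n := by exact_mod_cast M_pos n
  have ha : (1 : ℝ) ≤ a n := by exact_mod_cast one_le_a hn
  have hX : (X n : ℝ) ≤ P2X n := by exact_mod_cast (X_lt_P2X n).le
  rw [Sz.X] at hX; push_cast at hX
  have hP : (0 : ℝ) ≤ P2X n := Nat.cast_nonneg _
  have hn0 : (0 : ℝ) ≤ n := Nat.cast_nonneg _
  have hd : (0 : ℝ) ≤ d0 n := Nat.cast_nonneg _
  rw [t]; push_cast
  rw [show (128 : ℝ) * M n * P2X n * (a n / (64 * M n)) ^ 2 = P2X n * (a n) ^ 2 / (32 * M n) by field_simp; ring,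
    le_div_iff₀ (by positivity)]
  have h1 : (P2X n : ℝ) * 1 ≤ P2X n * (a n) ^ 2 := mul_le_mul_of_nonneg_left (by nlinarith) hP
  nlinarith [mul_nonneg (mul_nonneg hn0 (mul_nonneg hd hd)) hM.le]

end Sizes

/-! ### The bound at one security parameter -/

section MainBound

variable {f : List Bool → List Bool} {q p : Polynomial ℕ} {A₀ : List Bool → List Bool} {A : RandAlg (List Bool) (List Bool)} {n : ℕ}

/-- **The normalisation identity** `M · 2^{n + |coins|} = (M · 2^{aJ} · 2^{aR} · t) · Den · |𝒦|`, where `Den` is the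
denominator of `CandData.tcr_prob_le` for the coin types of the `(j, r)`-adversary. [cite: HaitnerEtAl2020, proof of Thm. 5.1, Step 5] -/
theorem norm_identity (hK : K n ≤ p.eval n) (κA : ℕ) :
    (M n : ℝ) * 2 ^ (n + (Inv.pre n q p + κA)) =
      ((M n * (2 ^ aJ n * 2 ^ aR n * t n) : ℕ) : ℝ) *
        ((Fintype.card (Xv n) : ℝ) ^ 2 * M n * ((Fintype.card (Xv n × Kv n × Fin (M n)) : ℝ) ^ t n * Fintype.card (G2v n) *
          (Fintype.card (G3v n) * (Fintype.card (CoinsJR n (q.eval n) (p.eval n - K n)) * Fintype.card (List.Vector Bool κA))))) *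
        Fintype.card (Kv n) := by
  have hnat : M n * 2 ^ (n + (Inv.pre n q p + κA)) = (M n * (2 ^ aJ n * 2 ^ aR n * t n)) *
      (Fintype.card (Xv n) ^ 2 * M n * (Fintype.card (Xv n × Kv n × Fin (M n)) ^ t n * Fintype.card (G2v n) *
        (Fintype.card (G3v n) * (Fintype.card (CoinsJR n (q.eval n) (p.eval n - K n)) * Fintype.card (List.Vector Bool κA))))) *
      Fintype.card (Kv n) := by
    rw [card_Xv, card_Kv, card_G2v, card_G3v, card_CoinsJR, card_vector, Fintype.card_bool,
      show Fintype.card (Xv n × Kv n × Fin (M n)) = 2 ^ d0 n from card_Dom (n := n)]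
    simp only [Inv.pre, Inv.L_eq, Inv.len, List.sum_cons, List.sum_nil, add_zero]
    generalize hlo : p.eval n - K n = lo
    have hp : p.eval n = K n + lo := by omega
    rw [hp, K, M, t_eq_pow]
    ring
  exact_mod_cast congrArg (fun k : ℕ => (k : ℝ)) hnat

/-- The residual `max(B,1)/|R₂| + 12|R₂|/(Nthr − 1)` for `B = 2^{2u(j−3)}`, `|R₂| = 2^{u(2j−5)}`, `Nthr = 2^{2u(j−2)}`,
`j ≥ 3`, `u ≥ 1`, is at most `25/2^u`. [cite: HaitnerEtAl2020, proof of Thm. 5.1, Steps 2–3 (parameters)] -/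
theorem residual_le {u j : ℕ} (hu : 1 ≤ u) (hj : 3 ≤ j) :
    ((max (2 ^ (2 * u * (j - 3))) 1 : ℕ) : ℝ) / ((2 : ℝ) ^ (u * (2 * j - 5))) +
        12 * (2 : ℝ) ^ (u * (2 * j - 5)) / ((((2 ^ (2 * u * (j - 2)) : ℕ) : ℝ)) - 1) ≤ 25 / 2 ^ u := by
  have h1 : u * (2 * j - 5) = 2 * u * (j - 3) + u := by
    zify [hj, show 5 ≤ 2 * j by omega, show 3 ≤ j from hj]; ring
  have h2 : 2 * u * (j - 2) = (2 * u * (j - 3) + u) + u := by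
    zify [hj, show 2 ≤ j by omega, show 3 ≤ j from hj]; ring
  rw [max_eq_left (Nat.one_le_two_pow), h1, h2]
  push_cast
  set A := (2 : ℝ) ^ (2 * u * (j - 3)) with hA
  set B := (2 : ℝ) ^ u with hB
  have hA1 : 1 ≤ A := one_le_pow₀ (by norm_num)
  have hB2 : 2 ≤ B := by rw [hB]; exact le_self_pow₀ (by norm_num) (by omega)
  rw [pow_add, pow_add, pow_add]
  have hAB : 2 ≤ A * B := by nlinarith [mul_nonneg (sub_nonneg.2 hA1) (sub_nonneg.2 hB2)]
  have hABB : 4 ≤ A * B * B := by nlinarith [mul_nonneg (sub_nonneg.2 hAB) (sub_nonneg.2 hB2)]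
  have hden : 0 < A * B * B - 1 := by linarith
  rw [show A / (A * B) = 1 / B by field_simp, div_add_div _ _ (by positivity) hden.ne', div_le_div_iff₀ (by positivity) (by positivity)]
  nlinarith [mul_nonneg (sub_nonneg.2 hA1) (by positivity : (0 : ℝ) ≤ B), mul_le_mul_of_nonneg_left hB2 (by positivity : (0 : ℝ) ≤ A * B)]

/-- The final algebra of the assembly, on generic reals: levelwise bounds `S_r ≤ M·X_r/D + ε`, the inverter
bridge `Σ_r K·X_r ≤ E·IP` and the normalisation identity `M·E = C·D·K` give `Σ_r S_r ≤ C·IP + m·ε`. [folklore] -/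
theorem sum_le_of_levelwise {Mr D Kc E IP Cc ε : ℝ} {m : ℕ} {S X : Fin m → ℝ} (hD : 0 < D) (hKc : 0 < Kc) (hMr : 0 ≤ Mr)
    (hid : Mr * E = Cc * D * Kc) (hsum : ∑ r, Kc * X r ≤ E * IP) (hS : ∀ r, S r ≤ Mr * X r / D + ε) :
    ∑ r, S r ≤ Cc * IP + (m : ℝ) * ε := by
  have h1 : ∑ r, S r ≤ ∑ r, (Mr * X r / D + ε) := Finset.sum_le_sum fun r _ => hS r
  have h2 : ∑ r : Fin m, (Mr * X r / D + ε) = Mr / (D * Kc) * ∑ r, Kc * X r + m * ε := by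
    rw [Finset.sum_add_distrib, Finset.sum_const, Finset.card_univ, Fintype.card_fin, nsmul_eq_mul, Finset.mul_sum]
    refine congrArg₂ (· + ·) (Finset.sum_congr rfl fun r _ => ?_) rfl
    field_simp
  have h3 : Mr / (D * Kc) * ∑ r, Kc * X r ≤ Mr / (D * Kc) * (E * IP) :=
    mul_le_mul_of_nonneg_left hsum (div_nonneg hMr (mul_pos hD hKc).le)
  have h4 : Mr / (D * Kc) * (E * IP) = Cc * IP := by
    rw [div_mul_eq_mul_div, ← mul_assoc, hid]; field_simp
  linarith only [h1, h2, h3, h4]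

/-- **The bound at one security parameter.** For `n ≥ 1` satisfying the collision-pair condition, the
restricted designated-collision probability of `family p f` is at most
`M·2^{aJ}·2^{aR}·t · Pr[inverter inverts f] + (R+1)·(3e^{−2n} + 25/2^{u})`.
[cite: HaitnerEtAl2020, Thm. 5.1 (proof, Steps 1–5) with Thm. 4.5] -/
theorem rtcrProb_le_of_collPairs (hf : IsLengthPreserving f) (hK : K n ≤ p.eval n) (hn : 1 ≤ n)
    (hCP : 8 * collPairs (fun x : Xv n => f x.toList) * M n ≤ Fintype.card (Xv n) ^ 2) :
    (family p f).rtcrProb (dLen p) (fun m => q.eval m) A₀ A n ≤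
      ((M n * (2 ^ aJ n * 2 ^ aR n * t n) : ℕ) : ℝ) * invertProb f (inverter f q p A₀ A) n +
        ((R n + 1 : ℕ) : ℝ) * (3 * Real.exp (-2 * n) + 25 / 2 ^ u n) := by
  classical
  -- the base data, independent of the grid index (opaque names, to keep unification syntactic)
  obtain ⟨F0, hF0⟩ : ∃ F : Xv n → List Bool, F = fun x => f x.toList := ⟨_, rfl⟩
  obtain ⟨HP0, hHP0⟩ : ∃ H : Kv n → ℕ → List Bool → Pv n, H = affinePrefix n (M n) (lK n) (padV n) := ⟨_, rfl⟩
  rw [← hF0] at hCP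
  have h2 : PrefixPairwise F0 HP0 (M n) := by
    have h := prefixPairwise_cand (n := n) (j := 0) hf; rwa [cand_f, cand_hp, ← hF0, ← hHP0] at h
  have h3 : PrefixThreewise F0 HP0 (M n) := by
    have h := prefixThreewise_cand (n := n) (j := 0) hf; rwa [cand_f, cand_hp, ← hF0, ← hHP0] at h
  have ha1 : (1 : ℝ) ≤ a n := by exact_mod_cast one_le_a hn
  have hM0 : (0 : ℝ) < M n := by exact_mod_cast M_pos n
  have hd0 : (0 : ℝ) < d0 n := by exact_mod_cast one_le_d0 n
  have hu1 : 1 ≤ u n := one_le_u hn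
  have hMX : Fintype.card (Xv n) < 2 ^ M n := by rw [card_Xv]; exact Nat.pow_lt_pow_right (by norm_num) (lt_M n)
  -- Theorem 4.5: the entropy gap (with `T := M`, `⌊log₂ T⌋ = a`)
  obtain ⟨Ea, hEa⟩ : ∃ E : ℝ, E = accEntropy (baseL F0 HP0 (M n) (M n)) := ⟨_, rfl⟩
  obtain ⟨Er, hEr⟩ : ∃ E : ℝ, E = realEntropy (baseF F0 HP0 (M n)) := ⟨_, rfl⟩
  have hgap : Ea + (a n : ℝ) / (12 * M n) ≤ Er := by
    have h := accEntropy_add_le_realEntropy (f := F0) (hp := HP0) (M_pos n) h2 h3 hMX (M_pos n) hCP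
    rw [log_M, ← hEa, ← hEr] at h
    exact_mod_cast h
  have hEa0 : 0 ≤ Ea := by rw [hEa]; exact accEntropy_nonneg_of_pos _ (card_baseL_pos F0 HP0 (M n) (M n))
  have hEr0 : 0 ≤ Er := le_trans (add_nonneg hEa0 (by positivity)) hgap
  haveI : Nonempty (Xv n × Kv n × Fin (M n)) :=
    ⟨(List.Vector.replicate n false, List.Vector.replicate (lK n) false, ⟨0, M_pos n⟩)⟩
  have hErle : Er ≤ d0 n := by
    have h := realEntropy_le_logb_card (F := baseF F0 HP0 (M n))
    rwa [logb_card_Dom, ← hEr] at h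
  -- the window and the grid index
  obtain ⟨c, hc⟩ : ∃ c : ℝ, c = (a n : ℝ) / (64 * M n) := ⟨_, rfl⟩
  have hc0 : 0 < c := by rw [hc]; positivity
  have htc : (t n : ℝ) * c = 2 * u n := by rw [hc]; exact t_mul_c n
  obtain ⟨hj4, hjlo, hjhi⟩ := window ha1 hM0 hEa0 hgap
  rw [← hc] at hj4 hjlo hjhi
  obtain ⟨j, hjdef⟩ : ∃ j : ℕ, j = ⌊Er / c⌋₊ := ⟨_, rfl⟩
  rw [← hjdef] at hj4 hjlo hjhi
  have hjY : j ≤ Y n := by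
    have h1 : (j : ℝ) ≤ Er / c := by rw [hjdef]; exact Nat.floor_le (div_nonneg hEr0 hc0.le)
    have h2 : Er / c ≤ 64 * M n * d0 n := by
      rw [div_le_iff₀ hc0]
      calc Er ≤ d0 n := hErle
        _ ≤ a n * d0 n := by nlinarith
        _ = 64 * M n * d0 n * c := by rw [hc]; field_simp
    have : (j : ℝ) ≤ Y n := by rw [Y]; push_cast; linarith
    exact_mod_cast this
  have hjJ : j < Jp1 n := lt_of_le_of_lt hjY (Y_lt_Jp1 n)
  set jv : Fin (Jp1 n) := ⟨j, hjJ⟩ with hjv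
  have hj3 : 3 ≤ j := by omega
  -- the parameters of `tcr_prob_le`
  obtain ⟨η, hη⟩ : ∃ η : ℝ, η = c / d0 n := ⟨_, rfl⟩
  have hη0 : 0 ≤ η := by rw [hη]; exact div_nonneg hc0.le hd0.le
  have hηd : (t n : ℝ) * η * d0 n = 2 * u n := by rw [hη, mul_div_assoc', div_mul_cancel₀ _ hd0.ne', htc]
  have hB : (2 : ℝ) ^ ((t n : ℝ) * accEntropy (baseL (cand n jv f).f (cand n jv f).hp (M n) (M n)) +
      (t n : ℝ) * η * Real.logb 2 (Fintype.card (Xv n × Kv n × Fin (M n)))) ≤ ((2 ^ (2 * u n * (j - 3)) : ℕ) : ℝ) := by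
    rw [cand_f, cand_hp, logb_card_Dom, ← hF0, ← hHP0, ← hEa, hηd, Nat.cast_pow, Nat.cast_two, ← Real.rpow_natCast]
    refine Real.rpow_le_rpow_of_exponent_le (by norm_num) ?_
    have h2 : (t n : ℝ) * Ea + 2 * u n ≤ 2 * u n * ((j : ℝ) - 3) := by
      have := mul_le_mul_of_nonneg_left hjhi (Nat.cast_nonneg (t n) : (0 : ℝ) ≤ t n)
      rwa [mul_add, htc, ← mul_assoc, htc] at this
    simp only [Nat.cast_mul, Nat.cast_sub hj3, Nat.cast_ofNat]
    exact h2
  have hNthr : 2 ≤ 2 ^ (2 * u n * (j - 2)) := by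
    calc 2 = 2 ^ 1 := by norm_num
      _ ≤ 2 ^ (2 * u n * (j - 2)) := Nat.pow_le_pow_right (by norm_num) (Nat.mul_pos (Nat.mul_pos (by norm_num) hu1) (by omega))
  have hN : (((2 ^ (2 * u n * (j - 2)) : ℕ) : ℝ)) ≤ (2 : ℝ) ^ ((t n : ℝ) * realEntropy (baseF (cand n jv f).f (cand n jv f).hp (M n)) -
      (t n : ℝ) * η * Real.logb 2 (Fintype.card (Xv n × Kv n × Fin (M n)))) := by
    rw [cand_f, cand_hp, logb_card_Dom, ← hF0, ← hHP0, ← hEr, hηd, Nat.cast_pow, Nat.cast_two, ← Real.rpow_natCast]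
    refine Real.rpow_le_rpow_of_exponent_le (by norm_num) ?_
    have h2 : 2 * u n * ((j : ℝ) - 1) ≤ (t n : ℝ) * Er := by
      have := mul_le_mul_of_nonneg_left hjlo (Nat.cast_nonneg (t n) : (0 : ℝ) ≤ t n)
      rwa [← mul_assoc, htc] at this
    simp only [Nat.cast_mul, Nat.cast_sub (show 2 ≤ j by omega), Nat.cast_ofNat]
    linarith only [h2]
  -- the single-candidate bounds, level by level
  have hT := fun r : Fin (R n + 1) => CandData.tcr_prob_le (M_pos n) (cand n jv f) (prefixPairwise_cand hf) (T := M n) (M_pos n)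
    (isPairwiseIndep_h₂ jv.isLt) (isThreewiseIndep_h₂ jv.isLt) (isPairwiseIndep_h₃ jv.isLt) (t_pos n) (one_lt_card_Dom (n := n)) hη0
    hB hNthr hN (two_mul_card_R3 (n := n)).le Fintype.card_pos
    (targetJR f n (q.eval n) (p.eval n - K n) A₀ jv r) (advJR f n (q.eval n) (p.eval n - K n) (A.coinLen (lenA q p n)) A jv r)
  -- the residuals
  have hexp : Real.exp (-2 * t n * η ^ 2) ≤ Real.exp (-2 * n) := by
    refine Real.exp_le_exp.2 ?_
    have h := n_mul_d0_sq_le hn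
    rw [← hc] at h
    have : (n : ℝ) ≤ t n * η ^ 2 := by
      rw [hη, div_pow, ← mul_div_assoc, le_div_iff₀ (pow_pos hd0 2)]; exact h
    linarith only [this]
  have hres := residual_le hu1 hj3 (u := u n) (j := j)
  have hε : 3 * Real.exp (-2 * t n * η ^ 2) + (((max (2 ^ (2 * u n * (j - 3))) 1 : ℕ) : ℝ) / (Fintype.card (R2v n jv) : ℝ) +
      12 * (Fintype.card (R2v n jv) : ℝ) / ((((2 ^ (2 * u n * (j - 2)) : ℕ) : ℝ)) - 1)) ≤ 3 * Real.exp (-2 * n) + 25 / 2 ^ u n := by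
    rw [card_R2, show ((jv : ℕ)) = j from rfl, ell, Nat.cast_pow, Nat.cast_two]
    linarith only [hexp, hres]
  -- the bridges and the normalisation identity
  have hB4 := rtcrProb_le_sum_card (q := q) (A₀ := A₀) (A := A) hf hK jv
  have hB3 := sum_card_mul_invSum_le_invertProb (q := q) (A₀ := A₀) (A := A) hf hK jv
  have hId := norm_identity (q := q) hK (A.coinLen (lenA q p n))
  -- positivity of the sizes
  have hX0 : (0 : ℝ) < Fintype.card (Xv n) := by exact_mod_cast Fintype.card_pos
  have hDom0 : (0 : ℝ) < Fintype.card (Xv n × Kv n × Fin (M n)) := by exact_mod_cast Fintype.card_pos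
  have hG20 : (0 : ℝ) < Fintype.card (G2v n) := by exact_mod_cast Fintype.card_pos
  have hG30 : (0 : ℝ) < Fintype.card (G3v n) := by exact_mod_cast Fintype.card_pos
  have hCJ0 : (0 : ℝ) < Fintype.card (CoinsJR n (q.eval n) (p.eval n - K n)) := by exact_mod_cast Fintype.card_pos
  have hΩ0 : (0 : ℝ) < Fintype.card (List.Vector Bool (A.coinLen (lenA q p n))) := by exact_mod_cast Fintype.card_pos
  have hKv0 : (0 : ℝ) < Fintype.card (Kv n) := by exact_mod_cast Fintype.card_pos
  have hDen0 : (0 : ℝ) < (Fintype.card (Xv n) : ℝ) ^ 2 * M n * ((Fintype.card (Xv n × Kv n × Fin (M n)) : ℝ) ^ t n * Fintype.card (G2v n) *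
      (Fintype.card (G3v n) * (Fintype.card (CoinsJR n (q.eval n) (p.eval n - K n)) * Fintype.card (List.Vector Bool (A.coinLen (lenA q p n)))))) :=
    mul_pos (mul_pos (pow_pos hX0 2) hM0) (mul_pos (mul_pos (pow_pos hDom0 _) hG20) (mul_pos hG30 (mul_pos hCJ0 hΩ0)))
  -- assemble
  exact hB4.trans (sum_le_of_levelwise hDen0 hKv0 hM0.le hId hB3 fun r => by
    have h := hT r
    rw [add_assoc, add_assoc] at h
    exact h.trans (add_le_add le_rfl hε))

end MainBound

/-! ### Negligibility and the leveled theorem -/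

section Asymptotic

variable {f : List Bool → List Bool} {p : Polynomial ℕ}

/-- `3e^{−2n} + 25/2^{u(n)} ≤ 28/2ⁿ` for `n ≥ 1`. [folklore] -/
theorem residual_le_div_two_pow {n : ℕ} (hn : 1 ≤ n) : 3 * Real.exp (-2 * n) + 25 / 2 ^ u n ≤ 28 / (2 : ℝ) ^ n := by
  have h2 : (0 : ℝ) < 2 ^ n := by positivity
  have he : Real.exp (-2 * n) ≤ 1 / (2 : ℝ) ^ n := by
    have h2e : (2 : ℝ) ≤ Real.exp 2 := by linarith [Real.add_one_le_exp (2 : ℝ)]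
    have hp : (2 : ℝ) ^ n ≤ Real.exp (2 * n) := by
      rw [show (2 : ℝ) * n = n * 2 by ring, Real.exp_nat_mul]
      exact pow_le_pow_left₀ (by norm_num) h2e n
    rw [show (-2 : ℝ) * n = -(2 * n) by ring, Real.exp_neg, ← one_div]
    exact one_div_le_one_div_of_le h2 hp
  have hu : 25 / (2 : ℝ) ^ u n ≤ 25 / (2 : ℝ) ^ n :=
    div_le_div_of_nonneg_left (by norm_num) h2 (pow_le_pow_right₀ (by norm_num) (le_u hn))
  calc 3 * Real.exp (-2 * n) + 25 / 2 ^ u n ≤ 3 * (1 / (2 : ℝ) ^ n) + 25 / (2 : ℝ) ^ n := by linarith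
    _ = 28 / (2 : ℝ) ^ n := by ring

/-- **Negligible designated collisions (leveled).** For a length-preserving one-way `f` and `p ≥ K`, every
polynomial `q`, every deterministic polynomial-time `A₀` and every PPT `A` form a designated collision inside the
domain of `family p f` only with negligible probability.
[cite: HaitnerEtAl2020, Thm. 5.1 with Thm. 4.5; Goldreich 2004, Thm. 6.4.29 (Rompel 1990)] -/
theorem superpolynomialDecay_rtcrProb (hf : IsOneWay f) (hlp : IsLengthPreserving f) (hK : ∀ n, K n ≤ p.eval n)
    (q : Polynomial ℕ) {A₀ : List Bool → List Bool} (hA₀ : A₀ ∈ FP) {A : RandAlg (List Bool) (List Bool)} (hA : IsPPT A id) :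
    SuperpolynomialDecay atTop (fun n : ℕ => (n : ℝ)) ((family p f).rtcrProb (dLen p) (fun m => q.eval m) A₀ A) := by
  -- the inverter is PPT, hence inverts with negligible probability
  have hneg := hf.2 _ (isPPT_inverter (q := q) (p := p) (A₀ := A₀) hf.1 hA₀ hA)
  -- polynomial bounds on the losses
  obtain ⟨P1, hP1⟩ := UExpr.exists_poly_le₁ (UExpr.mul E.M (UExpr.mul (UExpr.mul E.Jp1 (UExpr.pow2 E.R)) E.t))
  have hP1' : ∀ n, M n * (2 ^ aJ n * 2 ^ aR n * t n) ≤ P1.eval n := fun n => by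
    have h := hP1 n
    simp only [UExpr.eval, E.M_eval, E.Jp1_eval, E.R_eval, E.t_eval] at h
    exact h
  obtain ⟨P2, hP2⟩ := UExpr.exists_poly_le₁ (UExpr.add E.R (UExpr.cst 1))
  have hP2' : ∀ n, R n + 1 ≤ P2.eval n := fun n => by
    have h := hP2 n
    simp only [UExpr.eval, E.R_eval] at h
    exact h
  have hspd1 : SuperpolynomialDecay atTop (fun n : ℕ => (n : ℝ)) (fun n => ((P1.eval n : ℕ) : ℝ) * invertProb f (inverter f q p A₀ A) n) := by
    refine (hneg.polynomial_mul (P1.map (Nat.castRingHom ℝ))).congr fun n => ?_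
    rw [Polynomial.eval_map, Polynomial.eval₂_at_natCast]
    simp only [eq_natCast, Nat.cast_id]
  have hspd2 := superpolynomialDecay_natPoly_div_two_pow (C 28 * P2)
  refine (hspd1.add hspd2).trans_eventually_abs_le ?_
  filter_upwards [eventually_collPairs_cond hf hlp, eventually_ge_atTop 1] with n hCP hn
  simp only [Function.comp_apply, Pi.add_apply]
  have hIP := invertProb_nonneg f (inverter f q p A₀ A) n
  have h2n : (0 : ℝ) < 2 ^ n := by positivity
  have hb1 : ((M n * (2 ^ aJ n * 2 ^ aR n * t n) : ℕ) : ℝ) ≤ ((P1.eval n : ℕ) : ℝ) := by exact_mod_cast hP1' n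
  have hb2 : ((R n + 1 : ℕ) : ℝ) ≤ ((P2.eval n : ℕ) : ℝ) := by exact_mod_cast hP2' n
  have hres0 : 0 ≤ 3 * Real.exp (-2 * (n : ℝ)) + 25 / 2 ^ u n := by positivity
  have hmain := rtcrProb_le_of_collPairs (q := q) (A₀ := A₀) (A := A) hlp (hK n) hn hCP
  rw [abs_of_nonneg (HashCollection.rtcrProb_nonneg _ _ _ _ _ _), abs_of_nonneg (by positivity)]
  calc _ ≤ _ := hmain
    _ ≤ ((P1.eval n : ℕ) : ℝ) * invertProb f (inverter f q p A₀ A) n + ((P2.eval n : ℕ) : ℝ) * (28 / (2 : ℝ) ^ n) :=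
        add_le_add (mul_le_mul_of_nonneg_right hb1 hIP) (mul_le_mul hb2 (residual_le_div_two_pow hn) hres0 (Nat.cast_nonneg _))
    _ = _ := by rw [Polynomial.eval_mul, Polynomial.eval_C]; push_cast; ring

/-- **One-way functions give leveled `(d, d−1)`-restricted UOWHFs** (Rompel's theorem in the form proved by
HHRVW, Thm. 5.1 with Thm. 4.5; the keystone of Goldreich's Thm. 6.4.29): for a length-preserving one-way `f` and a
polynomial `p ≥ K`, the string family `family p f` is efficiently indexable and evaluable, maps the domain
`{0,1}^{d(|s|)}` to `{0,1}^{d(|s|)−1}`, has indices of length exactly `n + 1 + p(n)` at parameter `n`, and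
designated collisions inside the domain are negligible against every PPT adversary. (The renormalisation of the
index length to `n`, Def. 6.4.19 (1), and Steps II–IV of §6.4.3 are separate.)
[cite: HaitnerEtAl2020, Thm. 5.1; Goldreich 2004, Thm. 6.4.29 and Def. 6.4.19] -/
theorem family_leveled_ruowhf (hf : IsOneWay f) (hlp : IsLengthPreserving f) (hK : ∀ n, K n ≤ p.eval n) :
    (family p f).IsEfficient ∧
      (∀ s x : List Bool, x.length = dLen p s.length → ((family p f).hash s x).length = rLen p s.length) ∧
      (∀ L, rLen p L + 1 = dLen p L) ∧
      (∀ n, ∀ s ∈ ((family p f).indexPMF n).support, s.length = LenPres.M p n) ∧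
      ∀ q : Polynomial ℕ, ∀ A₀ : List Bool → List Bool, A₀ ∈ FP → ∀ A : RandAlg (List Bool) (List Bool), IsPPT A id →
        SuperpolynomialDecay atTop (fun n : ℕ => (n : ℝ)) ((family p f).rtcrProb (dLen p) (fun m => q.eval m) A₀ A) :=
  ⟨isEfficient_family hf.1, fun s x _ => length_family_hash f s x, rLen_add_one p, fun _ _ hs => length_index_family hs,
    fun q _ hA₀ _ hA => superpolynomialDecay_rtcrProb hf hlp hK q hA₀ hA⟩

/-- **Existence form**: if one-way functions exist then leveled `(d, d−1)`-restricted UOWHFs exist — some string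
family `H`, domain/range length functions `dL, rL` with `rL + 1 = dL`, and an index-length function `kL`, with the
four properties of `family_leveled_ruowhf`. [cite: HaitnerEtAl2020, Thm. 1.1 / Thm. 5.1; Rompel1990; Goldreich 2004, Thm. 6.4.29] -/
theorem exists_leveled_ruowhf_of_OWFExist (h : OWFExist) :
    ∃ (H : HashCollection) (dL rL kL : ℕ → ℕ), H.IsEfficient ∧
      (∀ s x : List Bool, x.length = dL s.length → (H.hash s x).length = rL s.length) ∧
      (∀ L, rL L + 1 = dL L) ∧ StrictMono kL ∧ (∃ P : Polynomial ℕ, ∀ n, kL n = P.eval n + n + 1) ∧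
      (∀ n, ∀ s ∈ (H.indexPMF n).support, s.length = kL n) ∧
      ∀ q : Polynomial ℕ, ∀ A₀ : List Bool → List Bool, A₀ ∈ FP → ∀ A : RandAlg (List Bool) (List Bool), IsPPT A id →
        SuperpolynomialDecay atTop (fun n : ℕ => (n : ℝ)) (H.rtcrProb dL (fun m => q.eval m) A₀ A) := by
  obtain ⟨f, hf, hlp⟩ := h.exists_isLengthPreserving
  obtain ⟨p, hp⟩ := UExpr.exists_poly_le₁ E.K
  have hK : ∀ n, K n ≤ p.eval n := fun n => by have h := hp n; simp only [E.K_eval] at h; exact h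
  obtain ⟨h1, h2, h3, h4, h5⟩ := family_leveled_ruowhf (p := p) hf hlp hK
  exact ⟨family p f, dLen p, rLen p, LenPres.M p, h1, h2, h3, LenPres.M_strictMono (p := p), ⟨p, fun n => rfl⟩, h4, h5⟩

end Asymptotic


end HHRVW

end Literature.Computability.Cryptography
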